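import Literature.Topology.Immersions.OpenParallelizableImmersion
import Literature.Topology.FourManifolds.OneManifoldLine
import Literature.Geometry.Manifold.OpenSubmanifoldTangent
import HarnessLib

/-!
# Open parallelizable manifolds immerse in `ℝⁿ`: reductions and the cases `n ≤ 1`

Topic `Literature/Topology/Immersions`; companion of `OpenParallelizableImmersion.lean`, which
vendors the named fact
`Literature.Topology.Immersions.Phillips1967_exists_isLocalDiffeomorph_of_isParallelizable`
(Phillips 1967, Cor. 8.2, "if" direction = Poenaru 1962, Théorème 5: *an open parallelizable
`n`-manifold submerges (immerses) in `ℝⁿ`*). Everything in this file is **proved**; no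
definitions and no named facts are introduced. It records the first, elementary steps of the
printed proof and settles the fact in dimensions `0` and `1`:

* `Literature.Topology.Immersions.exists_isLocalDiffeomorph_of_forall_connectedComponent` —
  **gluing along components**: a manifold each of whose connected components (open submanifolds,
  manifolds being locally connected) admits a `Cᵏ` local diffeomorphism into `N` admits one
  itself (the components are open and partition `M`; read each componentwise map on the ambient
  manifold with `isLocalDiffeomorphAt_of_comp_subtypeVal`). Phillips (§1, p. 176) works one
  component at a time: "attaching a handle of index `0` means taking the disjoint union".
* `Literature.Topology.FourManifolds.IsParallelizable.opens` — a global frame restricts to a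
  global frame of any open submanifold (`T_u U = T_u M`; O'Neill 1983, Ch. 2 pp. 36–37, via the
  tree's `OpenSubmanifold.contMDiff_tangentSection` in smoothness degree `0`).
* `Phillips1967_exists_isLocalDiffeomorph_of_isParallelizable_of_connected` (namespace
  `Literature.Topology.Immersions`) — **reduction to connected manifolds**: it suffices to
  submerge every *connected, non-compact* parallelizable `n`-manifold in `ℝⁿ` (a component
  of an open manifold is a connected manifold which is not compact, Phillips p. 171, and is
  parallelizable by restriction).
* `Literature.Topology.Immersions.isEmpty_of_chartedSpace_euclideanSpace_zero` — an open
  `0`-manifold is empty (its components are points, which are compact), whence the fact for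
  `n = 0` (`exists_isLocalDiffeomorph_of_chartedSpace_euclideanSpace_zero`, the empty map).
* `Literature.Topology.Immersions.exists_isLocalDiffeomorph_of_chartedSpace_euclideanSpace_one`
  — **the fact for `n = 1`** (here parallelizability is automatic and not assumed, so this is
  also Cor. 8.3 of Phillips — "an open manifold can be submerged in `R`" — in dimension `1`):
  every component of an open `1`-manifold is a connected non-compact `1`-manifold, hence
  diffeomorphic to `ℝ¹` (classification of `1`-manifolds, the tree's
  `Literature.Topology.FourManifolds.nonempty_diffeomorph_euclideanSpace_one_of_noncompactSpace`,
  Milnor, *Topology from the Differentiable Viewpoint*, Appendix), and these diffeomorphisms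
  glue to a local diffeomorphism `M → ℝ¹`.
* `Phillips1967_exists_isLocalDiffeomorph_of_isParallelizable_of_le_one` (namespace
  `Literature.Topology.Immersions`) — the named fact restricted to `n ≤ 1`, proved.

* `Literature.Topology.Immersions.isLocalDiffeomorph_iff_isInvertible_mfderiv` — in equal
  dimensions and without boundary, `Cⁿ` local diffeomorphisms (`1 ≤ n`) are exactly the `Cⁿ`
  maps with everywhere invertible differential (inverse function theorem), i.e. Phillips'
  *regular maps* (§0 p. 175); whence the fact in Phillips' own phrasing,
  `Phillips1967_exists_isLocalDiffeomorph_of_isParallelizable_iff_mfderiv`.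

The general case (`n ≥ 2`) is Phillips' Theorem B (§§1–7: proper Morse functions without
critical points of index `n`, the covering homotopy property of restriction maps between spaces
of submersions, induction over handles) and is not proved here.

## References

* A. Phillips, *Submersions of open manifolds*, Topology **6** (1967), 171–206: §0 p. 171
  ("open, i.e. has no compact components"), §1 p. 176, Cor. 8.2 and Cor. 8.3 (p. 196).
  [Phillips1967]
* J. Milnor, *Topology from the Differentiable Viewpoint* (1965), Appendix "Classifying
  1-manifolds", pp. 55–57. [MilnorTDV1965]
* B. O'Neill, *Semi-Riemannian Geometry* (1983), Ch. 1 p. 7, Ch. 2 pp. 36–37.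
  [ONeillSemiRiemannian1983]
* J. M. Lee, *Introduction to Smooth Manifolds*, 2nd ed., GTM 218 (2013), Thm. 4.5.
  [LeeSmoothManifolds2013]
-/

open scoped Manifold ContDiff Topology
open Set Function Bundle TopologicalSpace

noncomputable section

/-! ### Frames restrict to open submanifolds -/

namespace Literature.Topology.FourManifolds

variable {E H : Type*} [NormedAddCommGroup E] [NormedSpace ℝ E] [TopologicalSpace H]
  {I : ModelWithCorners ℝ E H} {M : Type*} [TopologicalSpace M] [ChartedSpace H M]
  [IsManifold I ∞ M]

/-- **Parallelizability restricts to open submanifolds**: a continuous global frame of `TM`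
(`M` a `C^∞` manifold) restricts to one of `TU` for every open subset `U ⊆ M` with its
open-submanifold structure
(`T_u U = T_u M`, and the local trivialisations of `TU` are the restrictions of those of `TM`:
the tree's `Literature.Geometry.Manifold.OpenSubmanifold.contMDiff_tangentSection` in degree `0`,
where `C⁰ = ` continuous). O'Neill, *Semi-Riemannian Geometry* (1983), Ch. 2, pp. 36–37
(restriction of tensor fields to open sets). [cite: ONeillSemiRiemannian1983, Ch. 2, pp. 36–37] -/
theorem IsParallelizable.opens (h : IsParallelizable I M) (U : Opens M) :
    IsParallelizable I U := by
  obtain ⟨s, hs, hli⟩ := h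
  refine ⟨fun i u => s i u.1, fun i => ?_, fun u => hli u.1⟩
  have h0 : ContMDiff I I.tangent 0
      (fun x : M => (TotalSpace.mk' E x (s i x) : TangentBundle I M)) :=
    contMDiff_zero_iff.2 (hs i)
  exact contMDiff_zero_iff.1
    (Literature.Geometry.Manifold.OpenSubmanifold.contMDiff_tangentSection h0 U)

end Literature.Topology.FourManifolds

namespace Literature.Topology.Immersions

open Literature.Topology.FourManifolds (IsParallelizable)

/-! ### Gluing local diffeomorphisms along connected components -/

section Components

variable {E H : Type*} [NormedAddCommGroup E] [NormedSpace ℝ E] [TopologicalSpace H]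
  {I : ModelWithCorners ℝ E H} {M : Type*} [TopologicalSpace M] [ChartedSpace H M]
  {E' H' : Type*} [NormedAddCommGroup E'] [NormedSpace ℝ E'] [TopologicalSpace H']
  {J : ModelWithCorners ℝ E' H'} {N : Type*} [TopologicalSpace N] [ChartedSpace H' N]
  {k : WithTop ℕ∞}

/-- **Local diffeomorphisms glue along connected components.** Let `M` be a locally connected
charted space (e.g. a manifold), so that its connected components are open and carry the
open-submanifold structure. If every component `connectedComponent x`, as an open submanifold,
admits a `Cᵏ` local diffeomorphism into `N`, then so does `M`: choose one such map per
component and define `f` componentwise; near each point `f` agrees, on the (open) component,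
with the chosen map read on the ambient manifold (`isLocalDiffeomorphAt_of_comp_subtypeVal`).
This is the disjoint-union step of Phillips' handle induction ("attaching a handle of index `0`
means taking the disjoint union", §0 p. 174, §1). [cite: Phillips1967, §1, p. 176] -/
theorem exists_isLocalDiffeomorph_of_forall_connectedComponent [LocallyConnectedSpace M]
    (h : ∀ x : M, ∃ g : (⟨connectedComponent x, isOpen_connectedComponent⟩ : Opens M) → N,
      IsLocalDiffeomorph I J k g) :
    ∃ f : M → N, IsLocalDiffeomorph I J k f := by
  classical
  -- one local diffeomorphism per component, the choice depending on the component only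
  have h' : ∀ U : Opens M, (∃ x : M, (U : Set M) = connectedComponent x) →
      ∃ g : U → N, IsLocalDiffeomorph I J k g := by
    rintro U ⟨x, hx⟩
    obtain rfl : U = ⟨connectedComponent x, isOpen_connectedComponent⟩ := Opens.ext hx
    exact h x
  choose g hg using h'
  set C : M → Opens M := fun x => ⟨connectedComponent x, isOpen_connectedComponent⟩ with hC
  have hCx : ∀ x : M, ∃ y : M, ((C x : Opens M) : Set M) = connectedComponent y :=
    fun x => ⟨x, rfl⟩
  have key : ∀ (U U' : Opens M), U = U' →
      ∀ (p : ∃ y : M, (U : Set M) = connectedComponent y)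
        (p' : ∃ y : M, (U' : Set M) = connectedComponent y) (z : U) (z' : U'),
        (z : M) = z' → g U p z = g U' p' z' := by
    rintro U _ rfl p p' z z' hzz'
    obtain rfl : z = z' := Subtype.ext hzz'
    rfl
  refine ⟨fun x => g (C x) (hCx x) ⟨x, mem_connectedComponent⟩, fun x => ?_⟩
  have hx : IsLocalDiffeomorphAt I J k (g (C x) (hCx x)) ⟨x, mem_connectedComponent⟩ :=
    hg (C x) (hCx x) ⟨x, mem_connectedComponent⟩
  refine isLocalDiffeomorphAt_of_comp_subtypeVal (U := C x) (u := ⟨x, mem_connectedComponent⟩)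
    hx fun v => ?_
  have hv : C (v : M) = C x := Opens.ext (connectedComponent_eq v.2).symm
  exact key _ _ hv _ _ _ _ rfl

end Components

/-! ### Reduction of the fact to connected manifolds -/

/-- **Components of an open manifold.** In an open manifold (no compact component) the component
of `x`, as an open submanifold, is a non-compact space.
[cite: Phillips1967, §0, p. 171] -/
theorem noncompactSpace_connectedComponent {M : Type*} [TopologicalSpace M]
    [LocallyConnectedSpace M] {x : M} (hx : ¬ IsCompact (connectedComponent x)) :
    NoncompactSpace (⟨connectedComponent x, isOpen_connectedComponent⟩ : Opens M) :=
  not_compactSpace_iff.1 fun hc => hx (isCompact_iff_compactSpace.2 hc)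

/-- The component of `x`, as an open subspace, is a connected space. [folklore] -/
theorem connectedSpace_connectedComponent {M : Type*} [TopologicalSpace M]
    [LocallyConnectedSpace M] (x : M) :
    ConnectedSpace (⟨connectedComponent x, isOpen_connectedComponent⟩ : Opens M) :=
  isConnected_iff_connectedSpace.1 isConnected_connectedComponent

/-- **Reduction to connected manifolds** (first step of the printed proof): to prove the fact
`Literature.Topology.Immersions.Phillips1967_exists_isLocalDiffeomorph_of_isParallelizable` it
suffices to submerge in `ℝⁿ` every **connected, non-compact**, parallelizable `C^∞`
`n`-manifold (Hausdorff, second countable). Indeed the components of an open manifold are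
open submanifolds which are connected and not compact (Phillips, §0 p. 171: "open, i.e. has no
compact components"), parallelizable by restriction of the frame (`IsParallelizable.opens`), and
componentwise submersions glue (`exists_isLocalDiffeomorph_of_forall_connectedComponent`).
[cite: Phillips1967, §0 p. 171 and §1 p. 176] -/
theorem Phillips1967_exists_isLocalDiffeomorph_of_isParallelizable_of_connected
    (h : ∀ (n : ℕ) (M : Type) [TopologicalSpace M] [T2Space M] [SecondCountableTopology M]
      [ChartedSpace (EuclideanSpace ℝ (Fin n)) M] [IsManifold (𝓡 n) ∞ M] [ConnectedSpace M]
      [NoncompactSpace M], IsParallelizable (𝓡 n) M →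
        ∃ f : M → EuclideanSpace ℝ (Fin n), IsLocalDiffeomorph (𝓡 n) (𝓡 n) ∞ f) :
    Phillips1967_exists_isLocalDiffeomorph_of_isParallelizable := by
  intro n M _ _ _ _ _ hopen hpar
  haveI : LocallyConnectedSpace M :=
    ChartedSpace.locallyConnectedSpace (EuclideanSpace ℝ (Fin n)) M
  refine exists_isLocalDiffeomorph_of_forall_connectedComponent fun x => ?_
  haveI := connectedSpace_connectedComponent x
  haveI := noncompactSpace_connectedComponent (hopen x)
  exact h n _ (hpar.opens _)

/-! ### Dimension `0`: open `0`-manifolds are empty -/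

/-- **An open `0`-manifold is empty.** In a charted space modelled on `ℝ⁰` (a point) every
singleton is open (it is the source of a chart, charts being injective into a one-point model),
and closed (`M` Hausdorff), so the component of `x` is `{x}`, which is compact — excluded by
openness. [cite: Phillips1967, §0, p. 171] -/
theorem isEmpty_of_chartedSpace_euclideanSpace_zero (M : Type*) [TopologicalSpace M] [T2Space M]
    [ChartedSpace (EuclideanSpace ℝ (Fin 0)) M]
    (hopen : ∀ x : M, ¬ IsCompact (connectedComponent x)) :
    IsEmpty M := by
  haveI : Subsingleton (EuclideanSpace ℝ (Fin 0)) :=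
    Module.finrank_zero_iff.1 finrank_euclideanSpace_fin
  refine ⟨fun x => hopen x ?_⟩
  have hsrc : (chartAt (EuclideanSpace ℝ (Fin 0)) x).source = {x} :=
    Subset.antisymm
      (fun y hy => (chartAt (EuclideanSpace ℝ (Fin 0)) x).injOn hy (mem_chart_source _ x)
        (Subsingleton.elim _ _))
      (singleton_subset_iff.2 (mem_chart_source _ x))
  have hclopen : IsClopen ({x} : Set M) :=
    ⟨isClosed_singleton, hsrc ▸ (chartAt (EuclideanSpace ℝ (Fin 0)) x).open_source⟩
  exact ((finite_singleton x).subset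
    (hclopen.connectedComponent_subset (mem_singleton x))).isCompact

/-- **The fact in dimension `0`**: an open `0`-manifold is empty, and the empty map is a local
diffeomorphism. [cite: Phillips1967, Cor. 8.2 (p. 196)] -/
theorem exists_isLocalDiffeomorph_of_chartedSpace_euclideanSpace_zero (M : Type*)
    [TopologicalSpace M] [T2Space M] [ChartedSpace (EuclideanSpace ℝ (Fin 0)) M]
    (hopen : ∀ x : M, ¬ IsCompact (connectedComponent x)) :
    ∃ f : M → EuclideanSpace ℝ (Fin 0), IsLocalDiffeomorph (𝓡 0) (𝓡 0) ∞ f := by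
  haveI := isEmpty_of_chartedSpace_euclideanSpace_zero M hopen
  exact ⟨isEmptyElim, fun x => isEmptyElim x⟩

/-! ### Dimension `1`: open `1`-manifolds submerge in `ℝ` -/

/-- **The fact in dimension `1`** (where parallelizability is automatic, so that this is at the
same time Phillips' Cor. 8.3 — "an open manifold can be submerged in `R`, i.e. `M` has a smooth
function with no critical points" — in dimension `1`): every open `C^∞` `1`-manifold `M`
(Hausdorff, second countable, no compact component) admits a `C^∞` local diffeomorphism into
`ℝ¹`. Each component of `M` is a connected non-compact `1`-manifold, hence diffeomorphic to
`ℝ¹` (classification of `1`-manifolds: Milnor, *Topology from the Differentiable Viewpoint*,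
Appendix; the tree's `nonempty_diffeomorph_euclideanSpace_one_of_noncompactSpace` in
`Literature.Topology.FourManifolds`), and these diffeomorphisms glue
(`exists_isLocalDiffeomorph_of_forall_connectedComponent`).
[cite: Phillips1967, Cor. 8.2 and Cor. 8.3 (p. 196)]
[cite: MilnorTDV1965, Appendix (Classifying 1-manifolds), pp. 55–57] -/
theorem exists_isLocalDiffeomorph_of_chartedSpace_euclideanSpace_one (M : Type*)
    [TopologicalSpace M] [T2Space M] [SecondCountableTopology M]
    [ChartedSpace (EuclideanSpace ℝ (Fin 1)) M] [IsManifold (𝓡 1) ∞ M]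
    (hopen : ∀ x : M, ¬ IsCompact (connectedComponent x)) :
    ∃ f : M → EuclideanSpace ℝ (Fin 1), IsLocalDiffeomorph (𝓡 1) (𝓡 1) ∞ f := by
  haveI : LocallyConnectedSpace M :=
    ChartedSpace.locallyConnectedSpace (EuclideanSpace ℝ (Fin 1)) M
  refine exists_isLocalDiffeomorph_of_forall_connectedComponent fun x => ?_
  haveI := connectedSpace_connectedComponent x
  haveI := noncompactSpace_connectedComponent (hopen x)
  obtain ⟨d⟩ :=
    Literature.Topology.FourManifolds.nonempty_diffeomorph_euclideanSpace_one_of_noncompactSpace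
      (M := (⟨connectedComponent x, isOpen_connectedComponent⟩ : Opens M))
  exact ⟨d, d.isLocalDiffeomorph⟩

/-- **Phillips 1967, Cor. 8.2 ("if" direction) in dimensions `n ≤ 1`, proved**: the named fact
`Literature.Topology.Immersions.Phillips1967_exists_isLocalDiffeomorph_of_isParallelizable`
restricted to `n ≤ 1` (`n = 0`: the manifold is empty; `n = 1`: components are lines).
[cite: Phillips1967, Cor. 8.2 (p. 196)] -/
theorem Phillips1967_exists_isLocalDiffeomorph_of_isParallelizable_of_le_one (n : ℕ)
    (hn : n ≤ 1) (M : Type) [TopologicalSpace M] [T2Space M] [SecondCountableTopology M]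
    [ChartedSpace (EuclideanSpace ℝ (Fin n)) M] [IsManifold (𝓡 n) ∞ M]
    (hopen : ∀ x : M, ¬ IsCompact (connectedComponent x)) (_hpar : IsParallelizable (𝓡 n) M) :
    ∃ f : M → EuclideanSpace ℝ (Fin n), IsLocalDiffeomorph (𝓡 n) (𝓡 n) ∞ f := by
  interval_cases n
  · exact exists_isLocalDiffeomorph_of_chartedSpace_euclideanSpace_zero M hopen
  · exact exists_isLocalDiffeomorph_of_chartedSpace_euclideanSpace_one M hopen


/-! ### Regular maps versus local diffeomorphisms (Phillips' phrasing of the conclusion) -/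

section Regular

variable {E : Type*} [NormedAddCommGroup E] [NormedSpace ℝ E] [CompleteSpace E]
  {H : Type*} [TopologicalSpace H] {I : ModelWithCorners ℝ E H} [I.Boundaryless]
  {M : Type*} [TopologicalSpace M] [ChartedSpace H M]
  {E' : Type*} [NormedAddCommGroup E'] [NormedSpace ℝ E']
  {H' : Type*} [TopologicalSpace H'] {J : ModelWithCorners ℝ E' H'} [J.Boundaryless]
  {N : Type*} [TopologicalSpace N] [ChartedSpace H' N] {n : WithTop ℕ∞}

/-- **Regular maps in equal dimensions are exactly the local diffeomorphisms.** For manifolds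
without boundary (complete model space on the source) and `1 ≤ n`, a map `f : M → N` is a `Cⁿ`
local diffeomorphism iff it is `Cⁿ` with everywhere invertible differential: "⇒" is Mathlib's
`IsLocalDiffeomorphAt.mfderivToContinuousLinearEquiv`, "⇐" the inverse function theorem on
manifolds (the tree's `Literature.Topology.FourManifolds.isLocalDiffeomorphAt_of_mfderiv`; Lee,
*Introduction to Smooth Manifolds* (2013), Thm. 4.5). This is the reading of Phillips'
*regular maps* `Mⁿ → Wⁿ` ("maps whose rank is the smaller of `n, p`", §0 p. 175:
submersions = immersions when `n = p`) as `IsLocalDiffeomorph` used in the statement of the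
fact.
[cite: Phillips1967, §0, p. 175] [cite: LeeSmoothManifolds2013, Thm. 4.5] -/
theorem isLocalDiffeomorph_iff_isInvertible_mfderiv [IsManifold I n M] [IsManifold J n N]
    (hn : 1 ≤ n) {f : M → N} :
    IsLocalDiffeomorph I J n f ↔ ContMDiff I J n f ∧ ∀ x, (mfderiv I J f x).IsInvertible := by
  have hn0 : n ≠ 0 := by
    rintro rfl
    exact not_lt.2 hn zero_lt_one
  constructor
  · intro hf
    exact ⟨hf.contMDiff, fun x => ⟨(hf x).mfderivToContinuousLinearEquiv hn0,
      (hf x).mfderivToContinuousLinearEquiv_coe hn0⟩⟩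
  · rintro ⟨hf, hinv⟩ x
    obtain ⟨L, hL⟩ := hinv x
    exact Literature.Topology.FourManifolds.isLocalDiffeomorphAt_of_mfderiv isOpen_univ
      (mem_univ x) hf.contMDiffOn hn L hL.symm

/-- Existence of a `Cⁿ` local diffeomorphism `M → N` (`1 ≤ n`, no boundary) is existence of a
`Cⁿ` *regular map* — a `Cⁿ` map with everywhere invertible differential (Phillips'
`Sub(Mⁿ, Wⁿ)` non-empty). [cite: Phillips1967, §0, p. 175] -/
theorem exists_isLocalDiffeomorph_iff_exists_isInvertible_mfderiv [IsManifold I n M]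
    [IsManifold J n N] (hn : 1 ≤ n) :
    (∃ f : M → N, IsLocalDiffeomorph I J n f) ↔
      ∃ f : M → N, ContMDiff I J n f ∧ ∀ x, (mfderiv I J f x).IsInvertible := by
  simp only [isLocalDiffeomorph_iff_isInvertible_mfderiv hn]

end Regular

/-- **The fact in Phillips' own phrasing** ("can be submerged in `Rⁿ`"): the named fact
`Literature.Topology.Immersions.Phillips1967_exists_isLocalDiffeomorph_of_isParallelizable` is
equivalent to the statement that every open parallelizable `C^∞` `n`-manifold carries a `C^∞`
map to `ℝⁿ` whose differential is invertible at every point (a submersion = immersion in equal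
dimensions), by `isLocalDiffeomorph_iff_isInvertible_mfderiv`.
[cite: Phillips1967, Cor. 8.2 (p. 196) and §0 p. 175] -/
theorem Phillips1967_exists_isLocalDiffeomorph_of_isParallelizable_iff_mfderiv :
    Phillips1967_exists_isLocalDiffeomorph_of_isParallelizable ↔
      ∀ (n : ℕ) (M : Type) [TopologicalSpace M] [T2Space M] [SecondCountableTopology M]
        [ChartedSpace (EuclideanSpace ℝ (Fin n)) M] [IsManifold (𝓡 n) ∞ M],
        (∀ x : M, ¬ IsCompact (connectedComponent x)) → IsParallelizable (𝓡 n) M →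
          ∃ f : M → EuclideanSpace ℝ (Fin n), ContMDiff (𝓡 n) (𝓡 n) ∞ f ∧
            ∀ x, (mfderiv (𝓡 n) (𝓡 n) f x).IsInvertible := by
  refine forall_congr' fun n => forall_congr' fun M => forall_congr' fun _ => forall_congr' fun _ =>
    forall_congr' fun _ => forall_congr' fun _ => forall_congr' fun _ => forall_congr' fun _ =>
    forall_congr' fun _ => ?_
  exact exists_isLocalDiffeomorph_iff_exists_isInvertible_mfderiv (by norm_num)

end Literature.Topology.Immersions
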